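import Summits.QuantumFields.QCD.Theses.CounterexampleMustBeHot
import Literature.MathematicalPhysics.QuantumFieldTheory.QCDThermalPartition

/-!
# Line `thermo-limits` — skeleton for the piece `FreeEnergyLimits` (stmt-QuantumFields-18759) of the
# decomposition of `ChiralColdCertificate` (stmt-QuantumFields-17303), crux-strategist r1

`FreeEnergyLimits`: for every lattice QCD scheme with `β_k ≥ 0` and all bare masses `m_f(k) > −1`
(Lüscher-positive branch), the thermal free energy per site `f_k(N_t, N_s) = −log‖Z_AP‖/(N_t N_s³)`
has spatial thermodynamic limits `φ_k(N_t)` and zero-temperature limits `e₀(k)` (the route's `Lim`).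

Stubs (three genuine lemmas; the composition `FreeEnergyLimits_of` is choice + bookkeeping):
* `stub_freeEnergyBounds` — POSITIVITY AND A-PRIORI BOUNDS: `Z_AP(N_t, N_s; β_k, m(k))` is real and
  positive (Lüscher's transfer matrix, `r = 1`, `|κ| < 1/6`, `β ≥ 0`: `Z_AP = Tr 𝒯^{N_t}`) and
  `|f_k(N_t, N_s)| ≤ C_k` uniformly in `N_t, N_s` (Hadamard/Haar bounds above, a small-field lower bound).
* `stub_spatialLimit` — the SPATIAL THERMODYNAMIC LIMIT at fixed `N_t` (the hard stub: no
  subadditivity for the signed non-local Wilson determinant when `1/8 ≤ κ < 1/6`; provable now for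
  `κ < 1/8` by the convergent hopping expansion = absolutely summable loop interaction, Ruelle §3.4).
* `stub_zeroTemperatureLimit` — the ZERO-TEMPERATURE LIMIT of the spatial limits (concavity of
  `N_t ↦ −log Tr 𝒯^{N_t}` survives `N_s → ∞`; a concave sequence with bounded slope converges in Cesàro).
-/

noncomputable section

namespace Summit.QuantumFields.QCD.Cruxes.ChiralColdCertificate.ThermoLimits

open scoped Topology
open Filter Literature.MathematicalPhysics.QuantumFieldTheory

/-! ### Vocabulary over the Literature definition `thermalFreeEnergyDensity` (definitionally the route's
inlined `let f`, checked by `Iff.rfl` below) -/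

/-- the thermodynamic (`N_s → ∞` at fixed `N_t`, shifted index `N_s + 1`) and zero-temperature (`N_t → ∞`)
limits of the thermal free energy per site along the scheme: the route's `Lim`. -/
def ThermoLim (Nf : ℕ) (sch : QCDScheme Nf) (φ : ℕ → ℕ → ℝ) (e₀ : ℕ → ℝ) : Prop :=
  (∀ (k Nt : ℕ) [NeZero Nt], Tendsto
      (fun Ns : ℕ => thermalFreeEnergyDensity Nf Nt (Ns + 1) (sch.β k) (fun fl => sch.mq fl k))
      atTop (𝓝 (φ k Nt))) ∧ ∀ k : ℕ, Tendsto (φ k) atTop (𝓝 (e₀ k))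

/-- the thermal degree-of-freedom count `F_k(N_t) = (90/π²) N_t⁴ (e₀(k) − φ_k(N_t))` (route's `F`). -/
def dof (φ : ℕ → ℕ → ℝ) (e₀ : ℕ → ℝ) (k Nt : ℕ) : ℝ :=
  90 / Real.pi ^ 2 * (Nt : ℝ) ^ 4 * (e₀ k - φ k Nt)

/-- its finite-volume twin `F^fin_k(N_t, N_s)` (route's `Ffin`). -/
def dofFin (Nf : ℕ) (sch : QCDScheme Nf) (e₀ : ℕ → ℝ) (k Nt Ns : ℕ) [NeZero Nt] [NeZero Ns] : ℝ :=
  90 / Real.pi ^ 2 * (Nt : ℝ) ^ 4 *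
    (e₀ k - thermalFreeEnergyDensity Nf Nt Ns (sch.β k) (fun fl => sch.mq fl k))

/-- the one-temperature, aspect-`≥ 1` cold certificate (route's `ColdFin`). -/
def ColdFinAt (Nf : ℕ) (sch : QCDScheme Nf) (e₀ : ℕ → ℝ) (η T₁ : ℝ) : Prop :=
  ∀ᶠ k in atTop, ∀ (Nt : ℕ) [NeZero Nt], Nt = ⌈(sch.a k * T₁)⁻¹⌉₊ →
    ∀ (Ns : ℕ) [NeZero Ns], Nt ≤ Ns → dofFin Nf sch e₀ k Nt Ns ≤ η

/-- `FreeEnergyLimits` in this vocabulary. -/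
def FreeEnergyLimitsLit : Prop :=
  ∀ Nf : ℕ, Nf = 2 ∨ Nf = 3 → ∀ sch : QCDScheme Nf, (∀ k : ℕ, 0 ≤ sch.β k) →
    (∀ (fl : Fin Nf) (k : ℕ), -1 < sch.mq fl k) → ∃ (φ : ℕ → ℕ → ℝ) (e₀ : ℕ → ℝ), ThermoLim Nf sch φ e₀

/-- STUB A — positivity of `Z_AP` and a-priori bounds on the free energy per site, uniformly in the
volume, at every step `k` (Lüscher 1977; Montvay–Münster (4.111)). -/
theorem stub_freeEnergyBounds : ∀ Nf : ℕ, Nf = 2 ∨ Nf = 3 → ∀ sch : QCDScheme Nf, (∀ k : ℕ, 0 ≤ sch.β k) →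
    (∀ (fl : Fin Nf) (k : ℕ), -1 < sch.mq fl k) → ∀ k : ℕ, ∃ C : ℝ, ∀ (Nt Ns : ℕ) [NeZero Nt] [NeZero Ns],
      0 < (qcdThermalPartition Nf Nt Ns (sch.β k) (fun fl => sch.mq fl k)).re ∧
      (qcdThermalPartition Nf Nt Ns (sch.β k) (fun fl => sch.mq fl k)).im = 0 ∧
      |thermalFreeEnergyDensity Nf Nt Ns (sch.β k) (fun fl => sch.mq fl k)| ≤ C := by
  sorry

/-- STUB B — the spatial thermodynamic limit of the free energy per site at fixed temporal extent,
given positivity and the a-priori bound (Ruelle 1969 §3.4 for the positive-weight range `κ < 1/8`;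
open for `1/8 ≤ κ < 1/6`). The limit FUNCTION over all `N_t ≥ 1` at once (choice). -/
theorem stub_spatialLimit : ∀ Nf : ℕ, Nf = 2 ∨ Nf = 3 → ∀ sch : QCDScheme Nf, (∀ k : ℕ, 0 ≤ sch.β k) →
    (∀ (fl : Fin Nf) (k : ℕ), -1 < sch.mq fl k) → ∀ (k : ℕ) (C : ℝ),
      (∀ (Nt Ns : ℕ) [NeZero Nt] [NeZero Ns],
        0 < (qcdThermalPartition Nf Nt Ns (sch.β k) (fun fl => sch.mq fl k)).re ∧
        (qcdThermalPartition Nf Nt Ns (sch.β k) (fun fl => sch.mq fl k)).im = 0 ∧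
        |thermalFreeEnergyDensity Nf Nt Ns (sch.β k) (fun fl => sch.mq fl k)| ≤ C) →
      ∃ φk : ℕ → ℝ, ∀ (Nt : ℕ) [NeZero Nt], Tendsto
        (fun Ns : ℕ => thermalFreeEnergyDensity Nf Nt (Ns + 1) (sch.β k) (fun fl => sch.mq fl k))
        atTop (𝓝 (φk Nt)) := by
  sorry

/-- STUB C — the zero-temperature limit: the spatial limits `φ_k(N_t)` converge as `N_t → ∞`
(`N_t φ_k(N_t)` is concave in `N_t` as a limit of `−N_s⁻³ log Tr 𝒯_{N_s}^{N_t}`, and `|φ_k| ≤ C_k`). -/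
theorem stub_zeroTemperatureLimit : ∀ Nf : ℕ, Nf = 2 ∨ Nf = 3 → ∀ sch : QCDScheme Nf,
    (∀ k : ℕ, 0 ≤ sch.β k) → (∀ (fl : Fin Nf) (k : ℕ), -1 < sch.mq fl k) → ∀ (k : ℕ) (C : ℝ),
      (∀ (Nt Ns : ℕ) [NeZero Nt] [NeZero Ns],
        0 < (qcdThermalPartition Nf Nt Ns (sch.β k) (fun fl => sch.mq fl k)).re ∧
        (qcdThermalPartition Nf Nt Ns (sch.β k) (fun fl => sch.mq fl k)).im = 0 ∧
        |thermalFreeEnergyDensity Nf Nt Ns (sch.β k) (fun fl => sch.mq fl k)| ≤ C) →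
      ∀ φk : ℕ → ℝ, (∀ (Nt : ℕ) [NeZero Nt], Tendsto
        (fun Ns : ℕ => thermalFreeEnergyDensity Nf Nt (Ns + 1) (sch.β k) (fun fl => sch.mq fl k))
        atTop (𝓝 (φk Nt))) → ∃ e : ℝ, Tendsto φk atTop (𝓝 e) := by
  sorry

/-- Composition in this vocabulary. -/
theorem freeEnergyLimitsLit_of_stubs
    (hA : ∀ Nf : ℕ, Nf = 2 ∨ Nf = 3 → ∀ sch : QCDScheme Nf, (∀ k : ℕ, 0 ≤ sch.β k) →
      (∀ (fl : Fin Nf) (k : ℕ), -1 < sch.mq fl k) → ∀ k : ℕ, ∃ C : ℝ, ∀ (Nt Ns : ℕ) [NeZero Nt] [NeZero Ns],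
        0 < (qcdThermalPartition Nf Nt Ns (sch.β k) (fun fl => sch.mq fl k)).re ∧
        (qcdThermalPartition Nf Nt Ns (sch.β k) (fun fl => sch.mq fl k)).im = 0 ∧
        |thermalFreeEnergyDensity Nf Nt Ns (sch.β k) (fun fl => sch.mq fl k)| ≤ C)
    (hB : ∀ Nf : ℕ, Nf = 2 ∨ Nf = 3 → ∀ sch : QCDScheme Nf, (∀ k : ℕ, 0 ≤ sch.β k) →
      (∀ (fl : Fin Nf) (k : ℕ), -1 < sch.mq fl k) → ∀ (k : ℕ) (C : ℝ),
        (∀ (Nt Ns : ℕ) [NeZero Nt] [NeZero Ns],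
          0 < (qcdThermalPartition Nf Nt Ns (sch.β k) (fun fl => sch.mq fl k)).re ∧
          (qcdThermalPartition Nf Nt Ns (sch.β k) (fun fl => sch.mq fl k)).im = 0 ∧
          |thermalFreeEnergyDensity Nf Nt Ns (sch.β k) (fun fl => sch.mq fl k)| ≤ C) →
        ∃ φk : ℕ → ℝ, ∀ (Nt : ℕ) [NeZero Nt], Tendsto
          (fun Ns : ℕ => thermalFreeEnergyDensity Nf Nt (Ns + 1) (sch.β k) (fun fl => sch.mq fl k))
          atTop (𝓝 (φk Nt)))
    (hC : ∀ Nf : ℕ, Nf = 2 ∨ Nf = 3 → ∀ sch : QCDScheme Nf,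
      (∀ k : ℕ, 0 ≤ sch.β k) → (∀ (fl : Fin Nf) (k : ℕ), -1 < sch.mq fl k) → ∀ (k : ℕ) (C : ℝ),
        (∀ (Nt Ns : ℕ) [NeZero Nt] [NeZero Ns],
          0 < (qcdThermalPartition Nf Nt Ns (sch.β k) (fun fl => sch.mq fl k)).re ∧
          (qcdThermalPartition Nf Nt Ns (sch.β k) (fun fl => sch.mq fl k)).im = 0 ∧
          |thermalFreeEnergyDensity Nf Nt Ns (sch.β k) (fun fl => sch.mq fl k)| ≤ C) →
        ∀ φk : ℕ → ℝ, (∀ (Nt : ℕ) [NeZero Nt], Tendsto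
          (fun Ns : ℕ => thermalFreeEnergyDensity Nf Nt (Ns + 1) (sch.β k) (fun fl => sch.mq fl k))
          atTop (𝓝 (φk Nt))) → ∃ e : ℝ, Tendsto φk atTop (𝓝 e)) :
    FreeEnergyLimitsLit := by
  intro Nf hNf sch hβ hm
  -- per step k: bounds (A), a spatial-limit function (B), its zero-temperature limit (C)
  have hk : ∀ k : ℕ, ∃ φk : ℕ → ℝ, (∀ (Nt : ℕ) [NeZero Nt], Tendsto
      (fun Ns : ℕ => thermalFreeEnergyDensity Nf Nt (Ns + 1) (sch.β k) (fun fl => sch.mq fl k))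
      atTop (𝓝 (φk Nt))) ∧ ∃ e : ℝ, Tendsto φk atTop (𝓝 e) := by
    intro k
    obtain ⟨C, hCb⟩ := hA Nf hNf sch hβ hm k
    obtain ⟨φk, hφk⟩ := hB Nf hNf sch hβ hm k C hCb
    exact ⟨φk, hφk, hC Nf hNf sch hβ hm k C hCb φk hφk⟩
  choose φ hφ e₀ he₀ using hk
  exact ⟨φ, e₀, fun k Nt _ => hφ k Nt, he₀⟩

/-- The piece is definitionally its Literature-vocabulary form (the inlined `let f` of the route IS
`thermalFreeEnergyDensity`, cf. the docstring of `QCDThermalPartition.lean`). -/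
theorem freeEnergyLimits_iff_lit :
    Summit.QuantumFields.QCD.Theses.CounterexampleMustBeHot.FreeEnergyLimits ↔ FreeEnergyLimitsLit :=
  Iff.rfl

/-- **Skeleton theorem — `FreeEnergyLimits` BY NAME from the registered stubs** (A12 shape: no hypotheses; the
only sorries of the file sit inside `stub_*`; once the stubs are proved this very theorem is the proof of
the piece). The sorry-free, kernel-checked composition with the stub statements as explicit hypotheses
is `freeEnergyLimitsLit_of_stubs` above (conclusion `FreeEnergyLimitsLit`,
definitionally the route decl: `freeEnergyLimits_iff_lit`). -/
theorem FreeEnergyLimits_of :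
    Summit.QuantumFields.QCD.Theses.CounterexampleMustBeHot.FreeEnergyLimits :=
  freeEnergyLimits_iff_lit.mpr
    (freeEnergyLimitsLit_of_stubs stub_freeEnergyBounds stub_spatialLimit stub_zeroTemperatureLimit)

end Summit.QuantumFields.QCD.Cruxes.ChiralColdCertificate.ThermoLimits

end
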